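import Summits.QuantumFields.YangMills.Theorems.UnitScaleTiltProp7SectET3DeltaPiT3PInv
import Summits.QuantumFields.YangMills.Theorems.UnitScaleTiltProp7KatoBootstrapMember
import Literature.MathematicalPhysics.QuantumFieldTheory.Balaban1983to89.B9Eq349ConjugatedQLettersCompanion
import HarnessLib

/-!
# Route `UnitScaleTilt`, crux K1 «MinimiserStabilityRegPr» (stmt-QuantumFields-19200), EX row `hPcol` — **P4b: THE ZERO-MODE PROJECTOR `P₀ = kerDProj U₀` IS HARMLESS IN SUP NORM:
# `‖(P₀ g)(x)‖ ≤ 4·sup_y ‖g(y)‖`** (LOCATE-hPcol v2 42098c54 §2), because `ker D_{U₀}` consists of covariantly constant sections — constant pointwise norm on the connected torus,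
# hence `dim ker D_{U₀} ≤ dim W₂ = 4` and every unit zero mode has pointwise size `(c₀·#sites)^{−1∕2}`.

Cell `ym3-torus` (HUMAN RULING D-0037; rung R3 = SU(2) YM₃ on T³ — NOT d = 4, NOT infinite volume, NOT a mass gap, NOT Clay).  Width seat `ym3-torus-px5` (gen 12).
THEOREMS ONLY (0 `def`, 0 `sorry`); `--supports stmt-QuantumFields-19200 --as helper`; count-neutral.

WHY.  The tree's `G′ᴾ` is the Moore–Penrose pseudo-inverse `(Δ′_a + P₀)⁻¹ − P₀` (✓`Prop7SectET3DeltaPiPInv`, HONESTY CLAUSE (C2′)), so P1 ✓`GprimeP_RS_eq` carries the projector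
`P₀` onto `ker D_{U₀}`: `R_S G′ᴾ = R_S G (1 − P₀)` (adjoint form).  The gradient row letter of P4a ✓`sum_norm_GprimeP_RS_DstarL2_single_le_of_gradient_row` is an `ℓ^∞ → ℓ^∞` bound, so
the knit needs `‖1 − P₀‖_{∞→∞} ≤ 1 + 4`, uniformly in the volume.  This is NOT a general fact about orthogonal projections (an `L²` projection can have `ℓ^∞` norm `√N`); it holds
because `D_{U₀}s = 0` forces `R(U₀(b))s(b₊) = s(b₋)` on every bond ((3.3); lit ✓`flat_of_covDerivL2K_eq_zero` pattern) with `R(U₀(b))` a `W₂`-ISOMETRY (unitary background), so `‖s(y)‖`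
is constant on the torus (connected by unit steps); then evaluation at one site is injective on `ker D` (`finrank ≤ 4`), and for an orthonormal basis `s_k` of `ker D`,
`|⟪s_k, g⟫|·‖s_k(x)‖ ≤ c₀·N·σ_k²·sup‖g‖ = ‖s_k‖²·sup‖g‖ = sup‖g‖`.
WHAT IS PROVED (ns `Summit.QuantumFields.YangMills.Theorems.Prop7KerDProjSupBound`).
* §2 (with V1 ✓`Prop7KatoBootstrapMember.norm_adBg_eq`: the member's transporter is a `W₂`-isometry) ★`adBg_equiv_shift_eq_of_DL2_eq_zero` (`D s = 0 ⟹ R(U₀(y,μ)) s(y + e_μ) = s(y)`), `norm_equiv_shift_eq_of_DL2_eq_zero`, `norm_equiv_iterate_shift_eq_of_DL2_eq_zero`.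
* §3 (the torus is connected by unit steps; lit ✓`iterate_shift_apply_val_self`∕`iterate_shift_apply_ne`) `exists_iterate_shift_apply_eq`, ★★`norm_equiv_eq_of_DL2_eq_zero` (`‖s(x)‖ = ‖s(y)‖` for ALL `x, y`).
* §4 ★`finrank_ker_DL2_le_four`; ★★★`norm_equiv_kerDProj_apply_le (g) (hg : ∀ y, ‖g(y)‖ ≤ Gb) (x) : ‖(P₀ g)(x)‖_{W₂} ≤ 4·Gb`; ★★`norm_equiv_sub_kerDProj_apply_le` (`‖((1 − P₀)g)(x)‖ ≤ 5·Gb`).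
HYP-SAT (★★OWNER RULING №42): no hypotheses beyond `D`'s letters (`U₀` arbitrary `SU(2)` background, any `g`, `Gb` = data); nothing eventual; conclusions non-vacuous.
HONEST SCOPE.  Linear algebra of the zero modes; nothing of `hPcol`, the ten EX rows, `hT`, `hGF`, EX `stub_existenceMinimalOrbit` or the crux is proved here; the Yang–Mills mass gap is NOT proved.

References: T. Bałaban, CMP **99** (1985) 389–434 [Balaban1985BackgroundPropagators] ((3.3) p.391 — `D_{U₀}` with the transporter `R(U₀(b))`; (3.21)–(3.25) p.394 — the zero modes and the
pseudo-inverse); CMP **102** (1985) 277–309 [Balaban1985Variational] ((139) p.299).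
-/

set_option autoImplicit false

noncomputable section

open scoped BigOperators InnerProductSpace ComplexConjugate Matrix.Norms.L2Operator

namespace Summit.QuantumFields.YangMills.Theorems.Prop7KerDProjSupBound

open Literature.MathematicalPhysics.QuantumFieldTheory.Balaban1983to89
open Literature.MathematicalPhysics.QuantumFieldTheory.Balaban1983to89.T3ContinuumYM3Torus
open T3SectALandauChart (eta eta_pos)
open B4Sect5Torus (TSite)
open B9SectCLatticeCarrier (Bond shift)
open B9Eq349ConjugatedQLettersCompanion (iterate_shift_apply_val_self iterate_shift_apply_ne)
open B9Eq311L2Pairing (WL2)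
open B9Eq33CovDerivVector (covDeriv covDeriv_apply_dir)
open B11Eq103H1Complex (SiteL2K BondL2K covDerivL2K equiv_covDerivL2K)
open Summit.QuantumFields.YangMills.Theorems.Prop7SectET3Transport (periodsT3 bgOfCfg isUnitaryBg_bgOfCfg)
open Summit.QuantumFields.YangMills.Theorems.Prop7SectET3HilbertLetters (W₂ adBg DL2)
open Summit.QuantumFields.YangMills.Theorems.Prop7KatoBootstrapMember (norm_adBg_eq)
open Summit.QuantumFields.YangMills.Theorems.Prop7SectET3DeltaPiPInv (kerDProj)

/-! ## §1 Letters -/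

variable (F : T3Family) {n K : ℕ} (c₀ : ℝ) [Fact (0 < c₀)]

/-! ## §2 `D_{U₀}s = 0` ⟹ `s` is covariantly constant, hence of constant pointwise norm along bonds (the transporter is a `W₂`-isometry, V1 ✓`norm_adBg_eq`) -/

/-- ★ `D_{U₀}s = 0 ⟹ R(U₀(y, μ)) s(y + e_μ) = s(y)` on every forward unit bond ((3.3) with `η⁻¹ ≠ 0`). [cite: Balaban1985BackgroundPropagators, (3.3) p.391, (3.24) p.394] -/
theorem adBg_equiv_shift_eq_of_DL2_eq_zero (U₀ : GaugeField (F.P K) 0 (Matrix.specialUnitaryGroup (Fin 2) ℂ)) {s : SiteL2K ℂ 3 (periodsT3 F K) c₀ W₂}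
    (hs : DL2 F n K c₀ U₀ s = 0) (y : TSite 3 (periodsT3 F K)) (μ : Fin 3) :
    adBg F K U₀ (y, μ) (WL2.equiv ℂ _ W₂ s (shift μ y)) = WL2.equiv ℂ _ W₂ s y := by
  have hD : covDeriv ((((eta F n K : ℝ) : ℂ))⁻¹) (adBg F K U₀) (WL2.equiv ℂ _ W₂ s) = 0 := by
    rw [← equiv_covDerivL2K]
    change WL2.equiv ℂ _ W₂ (DL2 F n K c₀ U₀ s) = 0
    rw [hs, WL2.equiv_zero]
  have hc : ((((eta F n K : ℝ) : ℂ))⁻¹) ≠ 0 := inv_ne_zero (Complex.ofReal_ne_zero.2 (eta_pos F n K).ne')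
  have hb := congr_fun hD (y, μ)
  rw [covDeriv_apply_dir, Pi.zero_apply, smul_eq_zero] at hb
  exact sub_eq_zero.1 (hb.resolve_left hc)

/-- `D_{U₀}s = 0 ⟹ ‖s(y + e_μ)‖ = ‖s(y)‖`. [cite: Balaban1985BackgroundPropagators, (3.3) p.391, (3.24) p.394] -/
theorem norm_equiv_shift_eq_of_DL2_eq_zero (U₀ : GaugeField (F.P K) 0 (Matrix.specialUnitaryGroup (Fin 2) ℂ)) {s : SiteL2K ℂ 3 (periodsT3 F K) c₀ W₂}
    (hs : DL2 F n K c₀ U₀ s = 0) (y : TSite 3 (periodsT3 F K)) (μ : Fin 3) :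
    ‖WL2.equiv ℂ _ W₂ s (shift μ y)‖ = ‖WL2.equiv ℂ _ W₂ s y‖ := by
  rw [← adBg_equiv_shift_eq_of_DL2_eq_zero F c₀ U₀ hs y μ, norm_adBg_eq]

/-- … iterated: `‖s(y + m·e_μ)‖ = ‖s(y)‖`. [cite: Balaban1985BackgroundPropagators, (3.3) p.391, (3.24) p.394] -/
theorem norm_equiv_iterate_shift_eq_of_DL2_eq_zero (U₀ : GaugeField (F.P K) 0 (Matrix.specialUnitaryGroup (Fin 2) ℂ)) {s : SiteL2K ℂ 3 (periodsT3 F K) c₀ W₂}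
    (hs : DL2 F n K c₀ U₀ s = 0) (μ : Fin 3) : ∀ (m : ℕ) (y : TSite 3 (periodsT3 F K)),
    ‖WL2.equiv ℂ _ W₂ s ((shift μ)^[m] y)‖ = ‖WL2.equiv ℂ _ W₂ s y‖
  | 0, y => rfl
  | m + 1, y => by
    rw [Function.iterate_succ_apply', norm_equiv_shift_eq_of_DL2_eq_zero F c₀ U₀ hs _ μ]
    exact norm_equiv_iterate_shift_eq_of_DL2_eq_zero U₀ hs μ m y

/-! ## §3 The torus `Π_i ℤ∕P_i` is connected by forward unit steps (lit ✓`B9Eq349ConjugatedQLettersCompanion.iterate_shift_apply_*`) -/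

section Torus

variable {d : ℕ} {Pd : Fin d → ℕ}

/-- Every value of the `k`-th coordinate is reached by iterated steps in direction `k`, the other coordinates unchanged. [folklore] -/
theorem exists_iterate_shift_apply_eq (k : Fin d) (x : TSite d Pd) (t : Fin (Pd k)) :
    ∃ m : ℕ, ((shift k)^[m] x) k = t ∧ ∀ i, i ≠ k → ((shift k)^[m] x) i = x i := by
  refine ⟨Pd k - (x k).val + t.val, Fin.ext ?_, fun i hi => iterate_shift_apply_ne hi x _⟩
  rw [iterate_shift_apply_val_self]
  have hx : (x k).val < Pd k := (x k).isLt
  have ht : t.val < Pd k := t.isLt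
  have h1 : (x k).val + (Pd k - (x k).val + t.val) = Pd k + t.val := by omega
  rw [h1, Nat.add_mod_left, Nat.mod_eq_of_lt ht]

end Torus

/-- ★★ **A ZERO MODE HAS CONSTANT POINTWISE NORM ON THE TORUS**: `D_{U₀}s = 0 ⟹ ‖s(x)‖_{W₂} = ‖s(y)‖_{W₂}` for all sites `x, y` (§2 along bonds, §3 connectedness — induction on the set of
coordinates where `x` and `y` differ). [cite: Balaban1985BackgroundPropagators, (3.3) p.391, (3.24) p.394] -/
theorem norm_equiv_eq_of_DL2_eq_zero (U₀ : GaugeField (F.P K) 0 (Matrix.specialUnitaryGroup (Fin 2) ℂ)) {s : SiteL2K ℂ 3 (periodsT3 F K) c₀ W₂}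
    (hs : DL2 F n K c₀ U₀ s = 0) (x y : TSite 3 (periodsT3 F K)) :
    ‖WL2.equiv ℂ _ W₂ s x‖ = ‖WL2.equiv ℂ _ W₂ s y‖ := by
  classical
  -- induction on a finset `S` outside of which `x` and `y` agree
  suffices h : ∀ (S : Finset (Fin 3)) (x : TSite 3 (periodsT3 F K)), (∀ i, i ∉ S → x i = y i) → ‖WL2.equiv ℂ _ W₂ s x‖ = ‖WL2.equiv ℂ _ W₂ s y‖ from
    h Finset.univ x (fun i hi => absurd (Finset.mem_univ i) hi)
  intro S
  induction S using Finset.induction with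
  | empty =>
    intro x hx
    have hxy : x = y := funext fun i => hx i (Finset.notMem_empty i)
    rw [hxy]
  | insert k S hk ih =>
    intro x hx
    -- move the `k`-th coordinate of `x` to that of `y` by iterated steps
    obtain ⟨m, hmk, hmi⟩ := exists_iterate_shift_apply_eq k x (y k)
    rw [← norm_equiv_iterate_shift_eq_of_DL2_eq_zero F c₀ U₀ hs k m x]
    refine ih _ fun i hi => ?_
    by_cases hik : i = k
    · subst hik; exact hmk
    · rw [hmi i hik]
      exact hx i (fun h => (Finset.mem_insert.1 h).elim hik hi)

/-! ## §4 `dim ker D_{U₀} ≤ 4` and the sup bound of `P₀` -/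

/-- ★ **`finrank ℂ (ker D_{U₀}) ≤ 4`**: evaluation at one site is injective on the zero modes (a zero mode vanishing at one site has zero norm everywhere, §3), and `dim_ℂ W₂ = 4`.
[cite: Balaban1985BackgroundPropagators, (3.24) p.394] -/
theorem finrank_ker_DL2_le_four (U₀ : GaugeField (F.P K) 0 (Matrix.specialUnitaryGroup (Fin 2) ℂ)) (y₀ : TSite 3 (periodsT3 F K)) :
    Module.finrank ℂ (LinearMap.ker (DL2 F n K c₀ U₀)) ≤ 4 := by
  -- evaluation at `y₀`, a linear map `ker D → W₂`
  let ev : LinearMap.ker (DL2 F n K c₀ U₀) →ₗ[ℂ] W₂ :=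
    { toFun := fun s => WL2.equiv ℂ _ W₂ (s : SiteL2K ℂ 3 (periodsT3 F K) c₀ W₂) y₀
      map_add' := fun s t => rfl
      map_smul' := fun c s => rfl }
  have hinj : Function.Injective ev := by
    intro s t hst
    apply Subtype.ext
    apply (WL2.equiv ℂ (fun _ : TSite 3 (periodsT3 F K) => c₀) W₂).injective
    funext y
    have hd : DL2 F n K c₀ U₀ ((s : SiteL2K ℂ 3 (periodsT3 F K) c₀ W₂) - (t : SiteL2K ℂ 3 (periodsT3 F K) c₀ W₂)) = 0 := by
      rw [map_sub, LinearMap.mem_ker.1 s.2, LinearMap.mem_ker.1 t.2, sub_zero]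
    have h0 : ‖WL2.equiv ℂ _ W₂ ((s : SiteL2K ℂ 3 (periodsT3 F K) c₀ W₂) - (t : SiteL2K ℂ 3 (periodsT3 F K) c₀ W₂)) y‖ = 0 := by
      rw [norm_equiv_eq_of_DL2_eq_zero F c₀ U₀ hd y y₀, WL2.equiv_sub, Pi.sub_apply]
      exact norm_eq_zero.2 (sub_eq_zero.2 hst)
    rw [WL2.equiv_sub, Pi.sub_apply] at h0
    exact sub_eq_zero.1 (norm_eq_zero.1 h0)
  have h := LinearMap.finrank_le_finrank_of_injective hinj
  rw [finrank_euclideanSpace, Fintype.card_prod, Fintype.card_fin] at h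
  exact h

/-- ★★★ **THE ZERO-MODE PROJECTOR IS HARMLESS IN SUP NORM**: `‖(P₀ g)(x)‖_{W₂} ≤ 4·Gb` whenever `‖g(y)‖_{W₂} ≤ Gb` for all `y` — uniformly in the volume.  With an orthonormal basis `s_k`
of `ker D_{U₀}`: `(P₀g)(x) = Σ_k ⟪s_k, g⟫·s_k(x)`, `|⟪s_k, g⟫| ≤ c₀·N·σ_k·Gb` and `c₀·N·σ_k² = ‖s_k‖² = 1` (`σ_k` = the constant pointwise norm of `s_k`, §3), `k ≤ 4` (`finrank_ker_DL2_le_four`).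
[cite: Balaban1985BackgroundPropagators, (3.11) p.392, (3.24) p.394] -/
theorem norm_equiv_kerDProj_apply_le (U₀ : GaugeField (F.P K) 0 (Matrix.specialUnitaryGroup (Fin 2) ℂ)) (g : SiteL2K ℂ 3 (periodsT3 F K) c₀ W₂) {Gb : ℝ}
    (hg : ∀ y, ‖WL2.equiv ℂ _ W₂ g y‖ ≤ Gb) (x : TSite 3 (periodsT3 F K)) :
    ‖WL2.equiv ℂ _ W₂ (kerDProj F n K c₀ U₀ g) x‖ ≤ 4 * Gb := by
  classical
  have hc₀ : 0 < c₀ := Fact.out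
  have hGb : 0 ≤ Gb := (norm_nonneg _).trans (hg x)
  set V := LinearMap.ker (DL2 F n K c₀ U₀) with hV
  haveI : CompleteSpace V := FiniteDimensional.complete ℂ _
  let b := stdOrthonormalBasis ℂ V
  -- `P₀ g = Σ_k ⟪s_k, g⟫ • s_k`
  have hP : kerDProj F n K c₀ U₀ g = ∑ k, ⟪((b k : V) : SiteL2K ℂ 3 (periodsT3 F K) c₀ W₂), g⟫_ℂ • ((b k : V) : SiteL2K ℂ 3 (periodsT3 F K) c₀ W₂) := by
    change V.starProjection g = _
    rw [Submodule.starProjection_apply, b.orthogonalProjectionOnto_apply_eq_sum, Submodule.coe_sum]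
    rfl
  -- each zero mode has constant pointwise norm `σ_k` with `c₀ · N · σ_k² = 1`
  have hmode : ∀ k, ‖⟪((b k : V) : SiteL2K ℂ 3 (periodsT3 F K) c₀ W₂), g⟫_ℂ‖ * ‖WL2.equiv ℂ _ W₂ ((b k : V) : SiteL2K ℂ 3 (periodsT3 F K) c₀ W₂) x‖ ≤ Gb := by
    intro k
    set s : SiteL2K ℂ 3 (periodsT3 F K) c₀ W₂ := ((b k : V) : SiteL2K ℂ 3 (periodsT3 F K) c₀ W₂) with hsdef
    have hsD : DL2 F n K c₀ U₀ s = 0 := LinearMap.mem_ker.1 (b k).2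
    have hconst : ∀ y, ‖WL2.equiv ℂ _ W₂ s y‖ = ‖WL2.equiv ℂ _ W₂ s x‖ := fun y => norm_equiv_eq_of_DL2_eq_zero F c₀ U₀ hsD y x
    -- `‖s‖ = 1`
    have hs1 : ‖s‖ = 1 := by
      rw [hsdef]
      exact_mod_cast b.orthonormal.1 k
    -- `1 = c₀ · N · σ²`
    have hσ : c₀ * (Fintype.card (TSite 3 (periodsT3 F K)) : ℝ) * ‖WL2.equiv ℂ _ W₂ s x‖ ^ 2 = 1 := by
      have h := WL2.norm_sq s
      rw [hs1, one_pow] at h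
      rw [h, Finset.sum_congr rfl fun y _ => by rw [hconst y], Finset.sum_const, Finset.card_univ, nsmul_eq_mul]
      ring
    -- `|⟪s, g⟫| ≤ c₀ · N · σ · Gb`
    have hinner : ‖⟪s, g⟫_ℂ‖ ≤ c₀ * (Fintype.card (TSite 3 (periodsT3 F K)) : ℝ) * ‖WL2.equiv ℂ _ W₂ s x‖ * Gb := by
      rw [WL2.inner_def]
      refine (norm_sum_le _ _).trans ?_
      have hterm : ∀ y, ‖(((fun _ : TSite 3 (periodsT3 F K) => c₀) y : ℝ) : ℂ) * ⟪WL2.equiv ℂ _ W₂ s y, WL2.equiv ℂ _ W₂ g y⟫_ℂ‖ ≤ c₀ * (‖WL2.equiv ℂ _ W₂ s x‖ * Gb) := by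
        intro y
        rw [norm_mul, Complex.norm_real, Real.norm_of_nonneg hc₀.le]
        refine mul_le_mul_of_nonneg_left ((norm_inner_le_norm _ _).trans ?_) hc₀.le
        rw [hconst y]
        exact mul_le_mul_of_nonneg_left (hg y) (norm_nonneg _)
      refine (Finset.sum_le_sum fun y _ => hterm y).trans ?_
      rw [Finset.sum_const, Finset.card_univ, nsmul_eq_mul]
      exact le_of_eq (by ring)
    calc ‖⟪s, g⟫_ℂ‖ * ‖WL2.equiv ℂ _ W₂ s x‖
        ≤ (c₀ * (Fintype.card (TSite 3 (periodsT3 F K)) : ℝ) * ‖WL2.equiv ℂ _ W₂ s x‖ * Gb) * ‖WL2.equiv ℂ _ W₂ s x‖ :=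
          mul_le_mul_of_nonneg_right hinner (norm_nonneg _)
      _ = (c₀ * (Fintype.card (TSite 3 (periodsT3 F K)) : ℝ) * ‖WL2.equiv ℂ _ W₂ s x‖ ^ 2) * Gb := by ring
      _ = Gb := by rw [hσ, one_mul]
  -- sum over the `≤ 4` modes
  have hcard : (Fintype.card (Fin (Module.finrank ℂ V)) : ℝ) ≤ 4 := by
    rw [Fintype.card_fin]
    exact_mod_cast finrank_ker_DL2_le_four F c₀ U₀ x
  -- evaluate the sum pointwise (the identification `WL2.linearEquiv` is linear)
  have hsum : WL2.equiv ℂ _ W₂ (∑ k, ⟪((b k : V) : SiteL2K ℂ 3 (periodsT3 F K) c₀ W₂), g⟫_ℂ • ((b k : V) : SiteL2K ℂ 3 (periodsT3 F K) c₀ W₂)) x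
      = ∑ k, ⟪((b k : V) : SiteL2K ℂ 3 (periodsT3 F K) c₀ W₂), g⟫_ℂ • WL2.equiv ℂ _ W₂ ((b k : V) : SiteL2K ℂ 3 (periodsT3 F K) c₀ W₂) x := by
    have e := congrFun (map_sum (WL2.linearEquiv ℂ ℂ (fun _ : TSite 3 (periodsT3 F K) => c₀) (V := W₂))
      (fun k => ⟪((b k : V) : SiteL2K ℂ 3 (periodsT3 F K) c₀ W₂), g⟫_ℂ • ((b k : V) : SiteL2K ℂ 3 (periodsT3 F K) c₀ W₂)) Finset.univ) x
    simp only [WL2.linearEquiv_apply, Finset.sum_apply, WL2.equiv_smul, Pi.smul_apply] at e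
    exact e
  rw [hP, hsum]
  calc ‖∑ k, ⟪((b k : V) : SiteL2K ℂ 3 (periodsT3 F K) c₀ W₂), g⟫_ℂ • WL2.equiv ℂ _ W₂ ((b k : V) : SiteL2K ℂ 3 (periodsT3 F K) c₀ W₂) x‖
      ≤ ∑ k, ‖⟪((b k : V) : SiteL2K ℂ 3 (periodsT3 F K) c₀ W₂), g⟫_ℂ • WL2.equiv ℂ _ W₂ ((b k : V) : SiteL2K ℂ 3 (periodsT3 F K) c₀ W₂) x‖ := norm_sum_le _ _
    _ = ∑ k, ‖⟪((b k : V) : SiteL2K ℂ 3 (periodsT3 F K) c₀ W₂), g⟫_ℂ‖ * ‖WL2.equiv ℂ _ W₂ ((b k : V) : SiteL2K ℂ 3 (periodsT3 F K) c₀ W₂) x‖ :=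
        Finset.sum_congr rfl fun k _ => norm_smul _ _
    _ ≤ ∑ _k : Fin (Module.finrank ℂ V), Gb := Finset.sum_le_sum fun k _ => hmode k
    _ = (Fintype.card (Fin (Module.finrank ℂ V)) : ℝ) * Gb := by rw [Finset.sum_const, Finset.card_univ, nsmul_eq_mul]
    _ ≤ 4 * Gb := mul_le_mul_of_nonneg_right hcard hGb

/-- ★★ **`‖((1 − P₀) g)(x)‖ ≤ 5·Gb`** — the form the hPcol knit uses on the input side of `R_S G′ᴾ = R_S G (1 − P₀)`. [cite: Balaban1985BackgroundPropagators, (3.24)–(3.25) p.394] -/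
theorem norm_equiv_sub_kerDProj_apply_le (U₀ : GaugeField (F.P K) 0 (Matrix.specialUnitaryGroup (Fin 2) ℂ)) (g : SiteL2K ℂ 3 (periodsT3 F K) c₀ W₂) {Gb : ℝ}
    (hg : ∀ y, ‖WL2.equiv ℂ _ W₂ g y‖ ≤ Gb) (x : TSite 3 (periodsT3 F K)) :
    ‖WL2.equiv ℂ _ W₂ (g - kerDProj F n K c₀ U₀ g) x‖ ≤ 5 * Gb := by
  rw [WL2.equiv_sub, Pi.sub_apply]
  refine (norm_sub_le _ _).trans ?_
  have h1 := hg x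
  have h2 := norm_equiv_kerDProj_apply_le F (n := n) c₀ U₀ g hg x
  linarith

end Summit.QuantumFields.YangMills.Theorems.Prop7KerDProjSupBound

end
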